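import Summits.Ventures.CertifiedManyBodySolver.Upper.BlochDressedCornerWindowsTTPrime
import HarnessLib

/-!
# Ventures/CertifiedManyBodySolver — Upper/BlochDressedPeriodicTTPrime.lean

HONEST FRAMING: first certified bounds; not a superconductivity verdict; every number certified or labelled float.

CELL PERIODICITY OF THE CORNER-LINK TERMS OF THE `t–t'` PLAQUETTE-DRESSED SLATER FUNCTIONAL (hubbard-fast-atlas-2; step D(ii) of the
`t–t'` twin of the chain `Upper/BlochDressed*.lean`; the plaquette and axial-link families are `Upper/BlochDressedPeriodic.lean`
verbatim; the corner window blocks are `Upper/BlochDressedCornerWindowsTTPrime.lean`; theorem-only, nothing is claimed). On the torus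
`(ℤ/2m)²` with an even magnetic cell (`M i = 2 q i`, `k i · M i = 2m`, `m ≥ 2`), a Bloch family `G σ κ` and a cell-periodic dressing
`u_c = v_{c mod q}`:
* `sum_comp_shiftCell_one` — reindexing the plaquette sum by `c = b + e₁` (puts both corner kinds on unit shifts of one base plaquette);
* **`sum_cornerTerm_eq_card_mul_sum_offset`** — the corner-link terms of `PlaquetteLUC.groundEnergy_torusTT'_le_dressed` at `P_G` sum to
  `|k| ·` the offset sum of the kind-`0` term (gates `v_r`, `v_{(r+(1,1)) mod q}`, window `W₁₆⁰(G;r)`) plus the kind-`1` term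
  (gates `v_{(r+e₁) mod q}`, `v_{(r+e₀) mod q}`, window `W₁₆¹(G;r)`);
* `sum_cornerNorm_eq_card_mul_sum_offset` — the same for the `ℓ¹`-masses of the dressed corner operators.
Sources: Bach–Lieb–Solovej 1994 eq. (3a.2) [BachLiebSolovej1994]. Everything is proved; no definition.
-/

noncomputable section

namespace Summit.Ventures.CertifiedManyBodySolver.Upper

open Matrix Finset
open Literature.MathematicalPhysics.QuantumLattice Literature.MathematicalPhysics.QuantumLattice.HartreeFock HeisenbergTL HubbardWave0
  PlaquetteLUC
open scoped ComplexConjugate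

variable {m : ℕ} [NeZero m] {k M : Fin 2 → ℕ} [∀ i, NeZero (k i)] [∀ i, NeZero (M i)] {q : Fin 2 → ℕ}

/-! ### §2. Periodic dressings: the corner-link sums are `|k|` copies of the offset sums -/

omit [∀ i, NeZero (k i)] [∀ i, NeZero (M i)] in
/-- Reindexing the plaquette sum by the shift `c = b + e₁`. [folklore] -/
theorem sum_comp_shiftCell_one {β : Type*} [AddCommMonoid β] (f : (Fin 2 → Fin m) → β) :
    ∑ c : Fin 2 → Fin m, f c = ∑ b : Fin 2 → Fin m, f (shiftCell b 1) := by
  rw [← Equiv.sum_comp (Equiv.addRight (Pi.single (1 : Fin 2) (1 : Fin m))) f]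
  rfl

/-- **Corner-link terms of a cell-periodic dressing.** If `u_c = v_{c mod q}` then the corner-link terms of the `t–t'` plaquette-dressed
functional (operators `C d` on the corner windows `cornerEmb hm c d`, gates `Γ(inl) u_c Γ(inr) u_{c + (1,±1)}`) sum to `|k| ·` the sum
over offsets `r` of: the kind-`0` term with gates `v_r`, `v_{(r+(1,1)) mod q}` and window `W₁₆⁰(G; r)`, plus the kind-`1` term (based at
`b = c − e₁`, `r = b mod q`) with gates `v_{(r+e₁) mod q}`, `v_{(r+e₀) mod q}` and window `W₁₆¹(G; r)`. [cite: BachLiebSolovej1994, eq. (3a.2)] -/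
theorem sum_cornerTerm_eq_card_mul_sum_offset (hkM : ∀ i, k i * M i = m * 2) (hq : ∀ i, M i = 2 * q i) (hm : 2 ≤ m)
    (hq0 : ∀ i, 0 < q i) (G : Fin 2 → RectTorusSite k → Matrix (RectTorusSite M) (RectTorusSite M) ℂ)
    (C : Fin 2 → Matrix (Finset (Orb (Fin 2 ×ₗ FermionTorus 2 2))) (Finset (Orb (Fin 2 ×ₗ FermionTorus 2 2))) ℂ)
    (u : (Fin 2 → Fin m) → Matrix (Finset (Orb (FermionTorus 2 2))) (Finset (Orb (FermionTorus 2 2))) ℂ)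
    (v : ((i : Fin 2) → Fin (q i)) → Matrix (Finset (Orb (FermionTorus 2 2))) (Finset (Orb (FermionTorus 2 2))) ℂ)
    (huv : ∀ c, u c = v (fun i => ⟨(c i : ℕ) % q i, Nat.mod_lt _ (hq0 i)⟩)) :
    ∑ ℓ : (Fin 2 → Fin m) × Fin 2, ∑ s : Finset (Orb (Fin 2 ×ₗ FermionTorus 2 2)), ∑ s' : Finset (Orb (Fin 2 ×ₗ FermionTorus 2 2)),
        ((fermionEmbed inlCell (u ℓ.1) * fermionEmbed inrCell (u (cornerShift ℓ.1 ℓ.2)))ᴴ * C ℓ.2 *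
            (fermionEmbed inlCell (u ℓ.1) * fermionEmbed inrCell (u (cornerShift ℓ.1 ℓ.2)))) s s' *
          slaterRDM ((spinBlock fun σ => blochMatrix hkM (G σ)).submatrix
            (fun a : Orb (Fin 2 ×ₗ FermionTorus 2 2) => orb (cornerEmb hm ℓ.1 ℓ.2 (ofLex a).1) (ofLex a).2)
            (fun a => orb (cornerEmb hm ℓ.1 ℓ.2 (ofLex a).1) (ofLex a).2)) s s' =
      (Fintype.card (RectTorusSite k) : ℂ) * ∑ r : (i : Fin 2) → Fin (q i),
        ((∑ s : Finset (Orb (Fin 2 ×ₗ FermionTorus 2 2)), ∑ s' : Finset (Orb (Fin 2 ×ₗ FermionTorus 2 2)),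
          ((fermionEmbed inlCell (v r) * fermionEmbed inrCell
                (v (fun i => ⟨((r i : ℕ) + 1) % q i, Nat.mod_lt _ (hq0 i)⟩)))ᴴ * C 0 *
              (fermionEmbed inlCell (v r) * fermionEmbed inrCell
                (v (fun i => ⟨((r i : ℕ) + 1) % q i, Nat.mod_lt _ (hq0 i)⟩)))) s s' *
            slaterRDM (Matrix.of fun o o' : Orb (Fin 2 ×ₗ FermionTorus 2 2) => if (ofLex o).2 = (ofLex o').2 then
              ((Fintype.card (RectTorusSite k) : ℂ))⁻¹ * ∑ κ, blockChar κ
                ((if (ofLex (ofLex o).1).1 = 0 then (0 : RectTorusSite k) else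
                    ((if (r 0 : ℕ) + 1 < q 0 then 0 else Pi.single 0 1) + (if (r 1 : ℕ) + 1 < q 1 then 0 else Pi.single 1 1))) -
                  (if (ofLex (ofLex o').1).1 = 0 then (0 : RectTorusSite k) else
                    ((if (r 0 : ℕ) + 1 < q 0 then 0 else Pi.single 0 1) + (if (r 1 : ℕ) + 1 < q 1 then 0 else Pi.single 1 1)))) *
                G (ofLex o).2 κ
                  (fun i => (((ofLex (ofLex (ofLex o).1).2 i : ℕ) + 2 * (if (ofLex (ofLex o).1).1 = 0 then (r i : ℕ) else
                    ((r i : ℕ) + 1) % q i) : ℕ) : ZMod (M i)))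
                  (fun i => (((ofLex (ofLex (ofLex o').1).2 i : ℕ) + 2 * (if (ofLex (ofLex o').1).1 = 0 then (r i : ℕ) else
                    ((r i : ℕ) + 1) % q i) : ℕ) : ZMod (M i))) else 0) s s') +
        (∑ s : Finset (Orb (Fin 2 ×ₗ FermionTorus 2 2)), ∑ s' : Finset (Orb (Fin 2 ×ₗ FermionTorus 2 2)),
          ((fermionEmbed inlCell (v (fun i => ⟨(if i = 1 then (r i : ℕ) + 1 else (r i : ℕ)) % q i, Nat.mod_lt _ (hq0 i)⟩)) *
              fermionEmbed inrCell (v (fun i => ⟨(if i = 0 then (r i : ℕ) + 1 else (r i : ℕ)) % q i, Nat.mod_lt _ (hq0 i)⟩)))ᴴ *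
              C 1 *
              (fermionEmbed inlCell (v (fun i => ⟨(if i = 1 then (r i : ℕ) + 1 else (r i : ℕ)) % q i, Nat.mod_lt _ (hq0 i)⟩)) *
                fermionEmbed inrCell (v (fun i => ⟨(if i = 0 then (r i : ℕ) + 1 else (r i : ℕ)) % q i, Nat.mod_lt _ (hq0 i)⟩)))) s s' *
            slaterRDM (Matrix.of fun o o' : Orb (Fin 2 ×ₗ FermionTorus 2 2) => if (ofLex o).2 = (ofLex o').2 then
              ((Fintype.card (RectTorusSite k) : ℂ))⁻¹ * ∑ κ, blockChar κ
                ((if (ofLex (ofLex o).1).1 = 0 then (if (r 1 : ℕ) + 1 < q 1 then (0 : RectTorusSite k) else Pi.single 1 1) else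
                    (if (r 0 : ℕ) + 1 < q 0 then (0 : RectTorusSite k) else Pi.single 0 1)) -
                  (if (ofLex (ofLex o').1).1 = 0 then (if (r 1 : ℕ) + 1 < q 1 then (0 : RectTorusSite k) else Pi.single 1 1) else
                    (if (r 0 : ℕ) + 1 < q 0 then (0 : RectTorusSite k) else Pi.single 0 1))) *
                G (ofLex o).2 κ
                  (fun i => (((ofLex (ofLex (ofLex o).1).2 i : ℕ) + 2 * (if i = (if (ofLex (ofLex o).1).1 = 0 then 1 else 0) then
                    ((r i : ℕ) + 1) % q i else (r i : ℕ)) : ℕ) : ZMod (M i)))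
                  (fun i => (((ofLex (ofLex (ofLex o').1).2 i : ℕ) + 2 * (if i = (if (ofLex (ofLex o').1).1 = 0 then 1 else 0) then
                    ((r i : ℕ) + 1) % q i else (r i : ℕ)) : ℕ) : ZMod (M i))) else 0) s s')) := by
  classical
  -- the two kinds as functions of the offset (of `c` for kind 0, of the base `b = c - e₁` for kind 1)
  obtain ⟨Φ, hΦ⟩ : ∃ Φ : (Fin 2 → ℕ) → ℂ, Φ = fun rN =>
      ∑ s : Finset (Orb (Fin 2 ×ₗ FermionTorus 2 2)), ∑ s' : Finset (Orb (Fin 2 ×ₗ FermionTorus 2 2)),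
        ((fermionEmbed inlCell (v (fun i => ⟨rN i % q i, Nat.mod_lt _ (hq0 i)⟩)) * fermionEmbed inrCell
              (v (fun i => ⟨(rN i + 1) % q i, Nat.mod_lt _ (hq0 i)⟩)))ᴴ * C 0 *
            (fermionEmbed inlCell (v (fun i => ⟨rN i % q i, Nat.mod_lt _ (hq0 i)⟩)) * fermionEmbed inrCell
              (v (fun i => ⟨(rN i + 1) % q i, Nat.mod_lt _ (hq0 i)⟩)))) s s' *
          slaterRDM (Matrix.of fun o o' : Orb (Fin 2 ×ₗ FermionTorus 2 2) => if (ofLex o).2 = (ofLex o').2 then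
            ((Fintype.card (RectTorusSite k) : ℂ))⁻¹ * ∑ κ, blockChar κ
              ((if (ofLex (ofLex o).1).1 = 0 then (0 : RectTorusSite k) else
                  ((if rN 0 + 1 < q 0 then 0 else Pi.single 0 1) + (if rN 1 + 1 < q 1 then 0 else Pi.single 1 1))) -
                (if (ofLex (ofLex o').1).1 = 0 then (0 : RectTorusSite k) else
                  ((if rN 0 + 1 < q 0 then 0 else Pi.single 0 1) + (if rN 1 + 1 < q 1 then 0 else Pi.single 1 1)))) *
              G (ofLex o).2 κ
                (fun i => (((ofLex (ofLex (ofLex o).1).2 i : ℕ) + 2 * (if (ofLex (ofLex o).1).1 = 0 then rN i else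
                  (rN i + 1) % q i) : ℕ) : ZMod (M i)))
                (fun i => (((ofLex (ofLex (ofLex o').1).2 i : ℕ) + 2 * (if (ofLex (ofLex o').1).1 = 0 then rN i else
                  (rN i + 1) % q i) : ℕ) : ZMod (M i))) else 0) s s' := ⟨_, rfl⟩
  obtain ⟨Ψ, hΨ⟩ : ∃ Ψ : (Fin 2 → ℕ) → ℂ, Ψ = fun rN =>
      ∑ s : Finset (Orb (Fin 2 ×ₗ FermionTorus 2 2)), ∑ s' : Finset (Orb (Fin 2 ×ₗ FermionTorus 2 2)),
        ((fermionEmbed inlCell (v (fun i => ⟨(if i = 1 then rN i + 1 else rN i) % q i, Nat.mod_lt _ (hq0 i)⟩)) *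
            fermionEmbed inrCell (v (fun i => ⟨(if i = 0 then rN i + 1 else rN i) % q i, Nat.mod_lt _ (hq0 i)⟩)))ᴴ * C 1 *
            (fermionEmbed inlCell (v (fun i => ⟨(if i = 1 then rN i + 1 else rN i) % q i, Nat.mod_lt _ (hq0 i)⟩)) *
              fermionEmbed inrCell (v (fun i => ⟨(if i = 0 then rN i + 1 else rN i) % q i, Nat.mod_lt _ (hq0 i)⟩)))) s s' *
          slaterRDM (Matrix.of fun o o' : Orb (Fin 2 ×ₗ FermionTorus 2 2) => if (ofLex o).2 = (ofLex o').2 then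
            ((Fintype.card (RectTorusSite k) : ℂ))⁻¹ * ∑ κ, blockChar κ
              ((if (ofLex (ofLex o).1).1 = 0 then (if rN 1 + 1 < q 1 then (0 : RectTorusSite k) else Pi.single 1 1) else
                  (if rN 0 + 1 < q 0 then (0 : RectTorusSite k) else Pi.single 0 1)) -
                (if (ofLex (ofLex o').1).1 = 0 then (if rN 1 + 1 < q 1 then (0 : RectTorusSite k) else Pi.single 1 1) else
                  (if rN 0 + 1 < q 0 then (0 : RectTorusSite k) else Pi.single 0 1))) *
              G (ofLex o).2 κ
                (fun i => (((ofLex (ofLex (ofLex o).1).2 i : ℕ) + 2 * (if i = (if (ofLex (ofLex o).1).1 = 0 then 1 else 0) then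
                  (rN i + 1) % q i else rN i) : ℕ) : ZMod (M i)))
                (fun i => (((ofLex (ofLex (ofLex o').1).2 i : ℕ) + 2 * (if i = (if (ofLex (ofLex o').1).1 = 0 then 1 else 0) then
                  (rN i + 1) % q i else rN i) : ℕ) : ZMod (M i))) else 0) s s' := ⟨_, rfl⟩
  -- `(c + 1) mod q = (c mod q + 1) mod q`
  have hmod1 : ∀ (c : Fin 2 → Fin m) (i : Fin 2), ((c i : ℕ) + 1) % q i = ((c i : ℕ) % q i + 1) % q i :=
    fun c i => (Nat.mod_add_mod _ _ _).symm
  -- kind 0 as a function of the offset of `c`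
  have hF0 : ∀ c : Fin 2 → Fin m, (∑ s : Finset (Orb (Fin 2 ×ₗ FermionTorus 2 2)), ∑ s' : Finset (Orb (Fin 2 ×ₗ FermionTorus 2 2)),
      ((fermionEmbed inlCell (u c) * fermionEmbed inrCell (u (cornerShift c 0)))ᴴ * C 0 *
          (fermionEmbed inlCell (u c) * fermionEmbed inrCell (u (cornerShift c 0)))) s s' *
        slaterRDM ((spinBlock fun σ => blochMatrix hkM (G σ)).submatrix
          (fun a : Orb (Fin 2 ×ₗ FermionTorus 2 2) => orb (cornerEmb hm c 0 (ofLex a).1) (ofLex a).2)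
          (fun a => orb (cornerEmb hm c 0 (ofLex a).1) (ofLex a).2)) s s') = Φ (fun i => (c i : ℕ) % q i) := by
    intro c
    have harg : (fun i => (⟨(c i : ℕ) % q i, Nat.mod_lt _ (hq0 i)⟩ : Fin (q i))) =
        fun i => ⟨((c i : ℕ) % q i) % q i, Nat.mod_lt _ (hq0 i)⟩ := funext fun i => Fin.ext (Nat.mod_mod _ _).symm
    have hargS : (fun i => (⟨(cornerShift c 0 i : ℕ) % q i, Nat.mod_lt _ (hq0 i)⟩ : Fin (q i))) =
        fun i => ⟨((c i : ℕ) % q i + 1) % q i, Nat.mod_lt _ (hq0 i)⟩ := by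
      funext i
      apply Fin.ext
      show (cornerShift c 0 i : ℕ) % q i = ((c i : ℕ) % q i + 1) % q i
      rw [mod_cornerShift_zero hkM hq hm, hmod1]
    rw [hΦ, cornerWindow_zero_eq_offset hkM hq hm G c, huv c, huv (cornerShift c 0), harg, hargS]
    simp only [hmod1 c]
  -- kind 1, based at `b = c - e₁`, as a function of the offset of `b`
  have hF1 : ∀ b : Fin 2 → Fin m, (∑ s : Finset (Orb (Fin 2 ×ₗ FermionTorus 2 2)), ∑ s' : Finset (Orb (Fin 2 ×ₗ FermionTorus 2 2)),
      ((fermionEmbed inlCell (u (shiftCell b 1)) * fermionEmbed inrCell (u (cornerShift (shiftCell b 1) 1)))ᴴ * C 1 *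
          (fermionEmbed inlCell (u (shiftCell b 1)) * fermionEmbed inrCell (u (cornerShift (shiftCell b 1) 1)))) s s' *
        slaterRDM ((spinBlock fun σ => blochMatrix hkM (G σ)).submatrix
          (fun a : Orb (Fin 2 ×ₗ FermionTorus 2 2) => orb (cornerEmb hm (shiftCell b 1) 1 (ofLex a).1) (ofLex a).2)
          (fun a => orb (cornerEmb hm (shiftCell b 1) 1 (ofLex a).1) (ofLex a).2)) s s') = Ψ (fun i => (b i : ℕ) % q i) := by
    intro b
    have hargS : ∀ j : Fin 2, (fun i => (⟨(shiftCell b j i : ℕ) % q i, Nat.mod_lt _ (hq0 i)⟩ : Fin (q i))) =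
        fun i => ⟨(if i = j then (b i : ℕ) % q i + 1 else (b i : ℕ) % q i) % q i, Nat.mod_lt _ (hq0 i)⟩ := by
      intro j
      funext i
      apply Fin.ext
      show (shiftCell b j i : ℕ) % q i = (if i = j then (b i : ℕ) % q i + 1 else (b i : ℕ) % q i) % q i
      rw [mod_shiftCell hkM hq hm]
      by_cases hij : i = j
      · subst hij; rw [if_pos rfl, if_pos rfl, Nat.mod_add_mod]
      · rw [if_neg hij, if_neg hij, Nat.mod_mod]
    rw [hΨ, cornerWindow_one_eq_offset hkM hq hm G b, cornerShift_shiftCell_one, huv (shiftCell b 1), huv (shiftCell b 0),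
      hargS 1, hargS 0]
    simp only [hmod1 b]
  -- split the kinds, reindex kind 1, reduce both to offset sums
  rw [Fintype.sum_prod_type]
  simp only [Fin.sum_univ_two]
  rw [Finset.sum_add_distrib, sum_comp_shiftCell_one (fun c => ∑ s : Finset (Orb (Fin 2 ×ₗ FermionTorus 2 2)),
      ∑ s' : Finset (Orb (Fin 2 ×ₗ FermionTorus 2 2)),
        ((fermionEmbed inlCell (u c) * fermionEmbed inrCell (u (cornerShift c 1)))ᴴ * C 1 *
            (fermionEmbed inlCell (u c) * fermionEmbed inrCell (u (cornerShift c 1)))) s s' *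
          slaterRDM ((spinBlock fun σ => blochMatrix hkM (G σ)).submatrix
            (fun a : Orb (Fin 2 ×ₗ FermionTorus 2 2) => orb (cornerEmb hm c 1 (ofLex a).1) (ofLex a).2)
            (fun a => orb (cornerEmb hm c 1 (ofLex a).1) (ofLex a).2)) s s'),
    Finset.sum_congr rfl fun c _ => hF0 c, Finset.sum_congr rfl fun b _ => hF1 b,
    sum_plaquette_eq_card_mul_sum_offset (k := k) (fun i => k_mul_q_eq hkM hq i) Φ,
    sum_plaquette_eq_card_mul_sum_offset (k := k) (fun i => k_mul_q_eq hkM hq i) Ψ, nsmul_eq_mul, nsmul_eq_mul, ← mul_add,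
    ← Finset.sum_add_distrib]
  congr 1
  refine Finset.sum_congr rfl fun r _ => ?_
  have harg : (fun i => (⟨(r i : ℕ) % q i, Nat.mod_lt _ (hq0 i)⟩ : Fin (q i))) = r :=
    funext fun i => Fin.ext (Nat.mod_eq_of_lt (Fin.isLt _))
  rw [hΦ, hΨ]
  simp only [harg]

omit [∀ i, NeZero (M i)] in
/-- **`ℓ¹`-masses of the dressed corner-link operators of a cell-periodic dressing** sum to `|k| ·` their offset sum (kind `0` with gates
`v_r`, `v_{(r+(1,1)) mod q}`; kind `1` with gates `v_{(r+e₁) mod q}`, `v_{(r+e₀) mod q}`). [folklore] -/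
theorem sum_cornerNorm_eq_card_mul_sum_offset (hkM : ∀ i, k i * M i = m * 2) (hq : ∀ i, M i = 2 * q i) (hm : 2 ≤ m)
    (hq0 : ∀ i, 0 < q i)
    (C : Fin 2 → Matrix (Finset (Orb (Fin 2 ×ₗ FermionTorus 2 2))) (Finset (Orb (Fin 2 ×ₗ FermionTorus 2 2))) ℂ)
    (u : (Fin 2 → Fin m) → Matrix (Finset (Orb (FermionTorus 2 2))) (Finset (Orb (FermionTorus 2 2))) ℂ)
    (v : ((i : Fin 2) → Fin (q i)) → Matrix (Finset (Orb (FermionTorus 2 2))) (Finset (Orb (FermionTorus 2 2))) ℂ)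
    (huv : ∀ c, u c = v (fun i => ⟨(c i : ℕ) % q i, Nat.mod_lt _ (hq0 i)⟩)) :
    ∑ ℓ : (Fin 2 → Fin m) × Fin 2, ∑ s : Finset (Orb (Fin 2 ×ₗ FermionTorus 2 2)), ∑ s' : Finset (Orb (Fin 2 ×ₗ FermionTorus 2 2)),
        ‖((fermionEmbed inlCell (u ℓ.1) * fermionEmbed inrCell (u (cornerShift ℓ.1 ℓ.2)))ᴴ * C ℓ.2 *
            (fermionEmbed inlCell (u ℓ.1) * fermionEmbed inrCell (u (cornerShift ℓ.1 ℓ.2)))) s s'‖ =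
      (Fintype.card (RectTorusSite k) : ℝ) * ∑ r : (i : Fin 2) → Fin (q i),
        ((∑ s : Finset (Orb (Fin 2 ×ₗ FermionTorus 2 2)), ∑ s' : Finset (Orb (Fin 2 ×ₗ FermionTorus 2 2)),
          ‖((fermionEmbed inlCell (v r) * fermionEmbed inrCell
                (v (fun i => ⟨((r i : ℕ) + 1) % q i, Nat.mod_lt _ (hq0 i)⟩)))ᴴ * C 0 *
              (fermionEmbed inlCell (v r) * fermionEmbed inrCell
                (v (fun i => ⟨((r i : ℕ) + 1) % q i, Nat.mod_lt _ (hq0 i)⟩)))) s s'‖) +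
        (∑ s : Finset (Orb (Fin 2 ×ₗ FermionTorus 2 2)), ∑ s' : Finset (Orb (Fin 2 ×ₗ FermionTorus 2 2)),
          ‖((fermionEmbed inlCell (v (fun i => ⟨(if i = 1 then (r i : ℕ) + 1 else (r i : ℕ)) % q i, Nat.mod_lt _ (hq0 i)⟩)) *
              fermionEmbed inrCell (v (fun i => ⟨(if i = 0 then (r i : ℕ) + 1 else (r i : ℕ)) % q i, Nat.mod_lt _ (hq0 i)⟩)))ᴴ *
              C 1 *
              (fermionEmbed inlCell (v (fun i => ⟨(if i = 1 then (r i : ℕ) + 1 else (r i : ℕ)) % q i, Nat.mod_lt _ (hq0 i)⟩)) *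
                fermionEmbed inrCell (v (fun i => ⟨(if i = 0 then (r i : ℕ) + 1 else (r i : ℕ)) % q i, Nat.mod_lt _ (hq0 i)⟩)))) s s'‖)) := by
  classical
  obtain ⟨Φ, hΦ⟩ : ∃ Φ : (Fin 2 → ℕ) → ℝ, Φ = fun rN =>
      ∑ s : Finset (Orb (Fin 2 ×ₗ FermionTorus 2 2)), ∑ s' : Finset (Orb (Fin 2 ×ₗ FermionTorus 2 2)),
        ‖((fermionEmbed inlCell (v (fun i => ⟨rN i % q i, Nat.mod_lt _ (hq0 i)⟩)) * fermionEmbed inrCell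
              (v (fun i => ⟨(rN i + 1) % q i, Nat.mod_lt _ (hq0 i)⟩)))ᴴ * C 0 *
            (fermionEmbed inlCell (v (fun i => ⟨rN i % q i, Nat.mod_lt _ (hq0 i)⟩)) * fermionEmbed inrCell
              (v (fun i => ⟨(rN i + 1) % q i, Nat.mod_lt _ (hq0 i)⟩)))) s s'‖ := ⟨_, rfl⟩
  obtain ⟨Ψ, hΨ⟩ : ∃ Ψ : (Fin 2 → ℕ) → ℝ, Ψ = fun rN =>
      ∑ s : Finset (Orb (Fin 2 ×ₗ FermionTorus 2 2)), ∑ s' : Finset (Orb (Fin 2 ×ₗ FermionTorus 2 2)),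
        ‖((fermionEmbed inlCell (v (fun i => ⟨(if i = 1 then rN i + 1 else rN i) % q i, Nat.mod_lt _ (hq0 i)⟩)) *
            fermionEmbed inrCell (v (fun i => ⟨(if i = 0 then rN i + 1 else rN i) % q i, Nat.mod_lt _ (hq0 i)⟩)))ᴴ * C 1 *
            (fermionEmbed inlCell (v (fun i => ⟨(if i = 1 then rN i + 1 else rN i) % q i, Nat.mod_lt _ (hq0 i)⟩)) *
              fermionEmbed inrCell (v (fun i => ⟨(if i = 0 then rN i + 1 else rN i) % q i, Nat.mod_lt _ (hq0 i)⟩)))) s s'‖ := ⟨_, rfl⟩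
  have hmod1 : ∀ (c : Fin 2 → Fin m) (i : Fin 2), ((c i : ℕ) + 1) % q i = ((c i : ℕ) % q i + 1) % q i :=
    fun c i => (Nat.mod_add_mod _ _ _).symm
  have hF0 : ∀ c : Fin 2 → Fin m, (∑ s : Finset (Orb (Fin 2 ×ₗ FermionTorus 2 2)), ∑ s' : Finset (Orb (Fin 2 ×ₗ FermionTorus 2 2)),
      ‖((fermionEmbed inlCell (u c) * fermionEmbed inrCell (u (cornerShift c 0)))ᴴ * C 0 *
          (fermionEmbed inlCell (u c) * fermionEmbed inrCell (u (cornerShift c 0)))) s s'‖) = Φ (fun i => (c i : ℕ) % q i) := by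
    intro c
    have harg : (fun i => (⟨(c i : ℕ) % q i, Nat.mod_lt _ (hq0 i)⟩ : Fin (q i))) =
        fun i => ⟨((c i : ℕ) % q i) % q i, Nat.mod_lt _ (hq0 i)⟩ := funext fun i => Fin.ext (Nat.mod_mod _ _).symm
    have hargS : (fun i => (⟨(cornerShift c 0 i : ℕ) % q i, Nat.mod_lt _ (hq0 i)⟩ : Fin (q i))) =
        fun i => ⟨((c i : ℕ) % q i + 1) % q i, Nat.mod_lt _ (hq0 i)⟩ := by
      funext i
      apply Fin.ext
      show (cornerShift c 0 i : ℕ) % q i = ((c i : ℕ) % q i + 1) % q i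
      rw [mod_cornerShift_zero hkM hq hm, hmod1]
    rw [hΦ, huv c, huv (cornerShift c 0), harg, hargS]
  have hF1 : ∀ b : Fin 2 → Fin m, (∑ s : Finset (Orb (Fin 2 ×ₗ FermionTorus 2 2)), ∑ s' : Finset (Orb (Fin 2 ×ₗ FermionTorus 2 2)),
      ‖((fermionEmbed inlCell (u (shiftCell b 1)) * fermionEmbed inrCell (u (cornerShift (shiftCell b 1) 1)))ᴴ * C 1 *
          (fermionEmbed inlCell (u (shiftCell b 1)) * fermionEmbed inrCell (u (cornerShift (shiftCell b 1) 1)))) s s'‖) =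
      Ψ (fun i => (b i : ℕ) % q i) := by
    intro b
    have hargS : ∀ j : Fin 2, (fun i => (⟨(shiftCell b j i : ℕ) % q i, Nat.mod_lt _ (hq0 i)⟩ : Fin (q i))) =
        fun i => ⟨(if i = j then (b i : ℕ) % q i + 1 else (b i : ℕ) % q i) % q i, Nat.mod_lt _ (hq0 i)⟩ := by
      intro j
      funext i
      apply Fin.ext
      show (shiftCell b j i : ℕ) % q i = (if i = j then (b i : ℕ) % q i + 1 else (b i : ℕ) % q i) % q i
      rw [mod_shiftCell hkM hq hm]
      by_cases hij : i = j
      · subst hij; rw [if_pos rfl, if_pos rfl, Nat.mod_add_mod]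
      · rw [if_neg hij, if_neg hij, Nat.mod_mod]
    rw [hΨ, cornerShift_shiftCell_one, huv (shiftCell b 1), huv (shiftCell b 0), hargS 1, hargS 0]
  rw [Fintype.sum_prod_type]
  simp only [Fin.sum_univ_two]
  rw [Finset.sum_add_distrib, sum_comp_shiftCell_one (fun c => ∑ s : Finset (Orb (Fin 2 ×ₗ FermionTorus 2 2)),
      ∑ s' : Finset (Orb (Fin 2 ×ₗ FermionTorus 2 2)),
        ‖((fermionEmbed inlCell (u c) * fermionEmbed inrCell (u (cornerShift c 1)))ᴴ * C 1 *
            (fermionEmbed inlCell (u c) * fermionEmbed inrCell (u (cornerShift c 1)))) s s'‖),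
    Finset.sum_congr rfl fun c _ => hF0 c, Finset.sum_congr rfl fun b _ => hF1 b,
    sum_plaquette_eq_card_mul_sum_offset (k := k) (fun i => k_mul_q_eq hkM hq i) Φ,
    sum_plaquette_eq_card_mul_sum_offset (k := k) (fun i => k_mul_q_eq hkM hq i) Ψ, nsmul_eq_mul, nsmul_eq_mul, ← mul_add,
    ← Finset.sum_add_distrib]
  congr 1
  refine Finset.sum_congr rfl fun r _ => ?_
  have harg : (fun i => (⟨(r i : ℕ) % q i, Nat.mod_lt _ (hq0 i)⟩ : Fin (q i))) = r :=
    funext fun i => Fin.ext (Nat.mod_eq_of_lt (Fin.isLt _))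
  rw [hΦ, hΨ]
  simp only [harg]

end Summit.Ventures.CertifiedManyBodySolver.Upper
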